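import Literature.NumberTheory.EllipticCurves.Kato2004.ZetaClassOnRankLeOneBranch
import Literature.NumberTheory.EllipticCurves.Kato2004.IwasawaCohomologyEulerSystemLiftComp
import Literature.NumberTheory.EllipticCurves.Kato2004.IntegralH1CorestrictionMackey
import Literature.NumberTheory.EllipticCurves.Kato2004.ValueGuardSatisfiableProofs
import Literature.NumberTheory.EllipticCurves.PAdicLFunctionMinusDenominatorsProofs
import Literature.NumberTheory.EllipticCurves.ModularSymbolsManinDrinfeldGeneralProofs
import Literature.NumberTheory.EllipticCurves.PAdicLFunctionProofs
import Literature.NumberTheory.EllipticCurves.NewformPeriodRatio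
import Literature.NumberTheory.GaloisRepresentations.CyclotomicCharacterSurjectiveProofs
import Summits.BirchSwinnertonDyer.BirchSwinnertonDyer.Theorems.UniversalToricDescentSigmaEulerMuZero
import Summits.BirchSwinnertonDyer.Rank1Residual.X12.CMSevenAwayFromSeven
import Summits.BirchSwinnertonDyer.Rank1Residual.Additive.RamifiedSevenPrimitiveAdmissibleMemberUpToUnit
import Mathlib.GroupTheory.Archimedean
import HarnessLib

/-!
# (E2) RESIDUAL LETTER `F•` + KERNEL ASSEMBLY — crux workfile, ideator bsd-idea-20 g68 (stmt-BirchSwinnertonDyer-19945)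

Crux `RamifiedSevenEllipticUnits.EllipticUnitValueSevenOfGZK`, line of record `Lines/kato_perrin_riou_zp.lean` v14
(sha16 6f202717661c60d4), stub (E2) `stub_muFreeRealisedFamilySeven` (UNOWNED, rank 4; pen D943: «residual = the REALISATION at
`W_K` with defined Tate-normalised values»).  PROOFS + two `Prop` letters; no `sorry`, no instance, no named fact, no `_holds`.
Nothing here proves (E2), the crux, or any summit statement; BSD is claimed for no curve.

WHAT THIS FILE DOES.  After g66 (`MuFreeMultiplierSeven_g66.lean`: the μ-free clause of
`Kato2004.HasMuFreeRealisedZetaFamilyBody` is AUTOMATIC in the diagonal gauge) and g67 (`RealisationExponent-g67.md`: `e = 0` at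
Kato's member `W_K`), the residual of (E2) is the REALISATION of the value-pinned family.  Here that residual is TYPED as ONE
`Prop` about `(W, p)` ALONE — `MemberRealisationBody W p` (§4), free of `K`, `γ`, `I`, of the gauge witnesses, of the Manin
coordinates `n₁ … n₄`, of the Galois elements `σ_c, σ_{d₁}, σ_ℓ`, of `e` and of the μ-clause — and the implication
`MemberRealisationBody W p → ∀ K hK γ I, HasMuFreeRealisedZetaFamilyBody W p K hK I` (`p` odd) is PROVED in the kernel (§5),
together with the member-form bridge to the (E2) stub statement VERBATIM (§6: `ClassCSevenMemberRealisation → <(E2)>`).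
The kernel supplies, clause by clause of the body (`ZetaClassOnRankLeOneBranch.lean` l.526–590):
* (A3) the gauge `(c, d₁, a, A, d′) = (1 + 6pA, 1 + 6pNA, a, A, 1)` and the four Manin coordinates `n₁ = … = n₄ = n`, `p ∤ n`
  — g66 ★ `exists_diagonalGauge` (INLINED verbatim as §0, namespace `…RealisationAssembly.G66`: crux workfiles are not importable on the farm);
* (A4) the Λ-adic lift `y ∈ I.H` of the `p`-power levels — tree `IwasawaH1Data.existsUnique_lift_of_isEulerSystem_of_integral`
  (Kato §13.1/Thm. 13.4), whose ONLY displayed input `hint` (integrality of the corestricted classes) is DISCHARGED here (§3,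
  `levelToLayer_mem_integralH1`) from clause (C2) of `ZetaBody` (unramified away from `p` at class level, (8.1.3) + §8.2) by the
  tree's Mackey functoriality `coresLe_mem_integralH1_of_le` (Kato §8.2 / Lemma 8.5, NSW (1.5.7)); so the realisation datum no
  longer mentions the pin `I` at all;
* (A5′) the Manin minus lattice generator `q⁻ > 0` with `ℤ·{[r]⁻_f} = ℤ·q⁻` — PROVED (§1, `exists_pos_closure_range_ratMinusSymbol`:
  Manin–Drinfeld bounded denominators `exists_forall_ratMinusSymbol_eq_div_of_maninDrinfeld` + «a subgroup of `(1/D)ℤ` is cyclic»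
  `AddSubgroup.cyclic_of_isolated_zero` + `exists_ratMinusSymbol_ne_zero`), until now only the hypothesis FIELD
  `MultiplierInputs.closure_range_ratMinusSymbol`; the Galois elements with `χ_cyc(σ_b) = b` for `b ∈ {c, d₁, ℓ}` — PROVED (§2) from
  the tree's `GaloisRep.cyclotomicCharacter_surjective`; the period ratio `ϖ ∈ ℚˣ` is kept INSIDE the letter verbatim (it is a
  consequence of the catalogued facts `nonempty_modularParametrizationData` + Carayol, tree
  `exists_ne_zero_rat_mul_realPeriodRat_eq_plusPeriod_of_facts`, recorded in §5 as a remark-lemma);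
* (μ) — g66 ★★ `muFree_conjunct_of_diagonalGauge` (§0); (e) — the letter carries `0 ≤ v_p(ϖ/(q·q⁻))` with `e`
  eliminated (g67: `= 0` at `W_K`).
What REMAINS print-level (= the letter's content, each clause page-anchored): (A0) a rational constant `q ≠ 0` of the value law
[Thm. 9.7 + Thm. 6.6: rationality and Galois equivariance of the values], (A1) the values ARE the dual exponential in a
coordinate `d` [`DefinedExpStarBody`: Thm. 12.5 (1)], (A2) `d` is Tate-normalised [`exp*_ω · log_ω` local duality, BK90 Prop. 3.8],
(A3)-∀gauge: for EVERY admissible gauge the Euler system with these values EXISTS [(8.1.3) for all `(c, d)` prime to `6p`/`6pN`,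
Ex. 13.3/(13.1.1) for all `ξ = a(A)`; Prop. 8.12 norm relations; §8.2 integrality], and `0 ≤ e` [§13.12–13.14 with g67 §2].

[cite: Kato2004Asterisque, (8.1.3) (p. 180), §8.2 and Lemma 8.5 (pp. 180–184), Prop. 8.12 (p. 186), Thm. 9.7 (p. 189), Thm. 12.5 (1) (p. 221), §13.1 and Thm. 13.4 (pp. 224–226), Ex. 13.3 (p. 225), Lemma 13.10 (1) (p. 230), §13.12–13.14 (pp. 231–234)]
[cite: BlochKato1990, Prop. 3.8 (p. 354)] [cite: Manin1972, Thm. 1.6 and Cor. 3.6] [cite: MazurTateTeitelbaum1986Invent, §I.8]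
[cite: NeukirchSchmidtWingberg2008, (1.5.7)] [cite: Washington1997, Ch. 14 (p. 321)]
-/

set_option autoImplicit false
set_option linter.dupNamespace false

noncomputable section

/-! ## §0 INLINED COPY of g66 `MuFreeMultiplierSeven_g66.lean` (tree sha16 66d29e3b022a13de, l.74–542 VERBATIM; critic
V#22ct PASS) under the namespace `…RealisationAssembly.G66` — crux workfiles are not built on the Lean farm, so the g66 module cannot be
imported (`lean check` → `remote:stale:unbuilt:….MuFreeMultiplierSeven_g66`, rc 75 ×3, 2026-08-30T20:5xZ); nothing in §0 is new. -/

section G66Inline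

open scoped Classical MatrixGroups ModularForm
open CongruenceSubgroup PowerSeries Field
open Literature.NumberTheory.EllipticCurves Literature.NumberTheory.EllipticCurves.Kato2004
  Literature.NumberTheory.EllipticCurves.IwasawaCharacter Literature.NumberTheory.GaloisRepresentations
open Summit.BirchSwinnertonDyer.Rank1Residual.X11b.SigmaEulerMu

namespace Summit.BirchSwinnertonDyer.BirchSwinnertonDyer.Cruxes.EllipticUnitValueSevenOfGZK.RealisationAssembly.G66

variable {p : ℕ} [hp : Fact p.Prime]

/-! ## §0.1 Images of `(1+T)^x` in `𝔽_p⟦T⟧ = Λ/pΛ` (any prime `p`) -/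

section Images

/-- A power series over `𝔽_p` with constant coefficient `1` is non-zero. [folklore] -/
theorem ne_zero_of_constantCoeff_eq_one {F : PowerSeries (ZMod p)} (h : PowerSeries.constantCoeff F = 1) : F ≠ 0 := by
  intro hF
  rw [hF, map_zero] at h
  exact zero_ne_one h

/-- The image of `(1+T)^x` in `𝔽_p⟦T⟧` has constant coefficient `1`. [cite: Washington1997, §7.2] -/
theorem constantCoeff_map_onePlusTPow (x : ℤ_[p]) :
    PowerSeries.constantCoeff
      (PowerSeries.map (PadicInt.toZMod (p := p)) (onePlusTPow p ℤ_[p] x : IwasawaAlgebra p)) = 1 := by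
  rw [← PowerSeries.coeff_zero_eq_constantCoeff_apply, PowerSeries.coeff_map, val_onePlusTPow,
    PowerSeries.coeff_zero_eq_constantCoeff_apply, PowerSeries.binomialSeries_constantCoeff, map_one]

/-- **`(1+T)^x ≢ 1 (mod p)` for `x ≠ 0`**, read in `𝔽_p⟦T⟧` (the tree's Lucas-free lemma
`SigmaEulerMu.not_C_p_dvd_onePlusTPow_sub_one`). [cite: Washington1997, §7.2 and §13.1] -/
theorem map_onePlusTPow_ne_one {x : ℤ_[p]} (hx : x ≠ 0) :
    PowerSeries.map (PadicInt.toZMod (p := p)) (onePlusTPow p ℤ_[p] x : IwasawaAlgebra p) ≠ 1 := by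
  intro h
  apply not_C_p_dvd_onePlusTPow_sub_one (p := p) hx
  rw [C_p_dvd_iff_map_toZMod_eq_zero, map_sub, map_one, h, sub_self]

/-- `(p : Λ) = C p`: the natural-number cast and the constant agree, so `(p : Λ) ∣ F ↔ C p ∣ F`. [folklore] -/
theorem natCast_dvd_iff_C_dvd (F : IwasawaAlgebra p) :
    (p : IwasawaAlgebra p) ∣ F ↔ (PowerSeries.C (p : ℤ_[p]) : IwasawaAlgebra p) ∣ F := by
  rw [map_natCast]

end Images

/-! ## §0.2 The three factor lemmas in the domain `𝔽_p⟦T⟧` -/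

section Factors

/-- **Linear factor**: `d̄ − v ≠ 0` in `𝔽_p⟦T⟧` for `v` with constant coefficient `1` and `v ≠ 1` (if `v = d̄` is a constant
with constant coefficient `1` then `v = 1`). [cite: Kato2004Asterisque, §13.9 (p. 229)] [cite: Washington1997, §7.2] -/
theorem linearFactor_ne_zero {v : PowerSeries (ZMod p)} (hv0 : PowerSeries.constantCoeff v = 1) (hv : v ≠ 1) (d : ℤ) :
    (d : PowerSeries (ZMod p)) - v ≠ 0 := by
  intro h
  have hvd : v = (d : PowerSeries (ZMod p)) := (sub_eq_zero.mp h).symm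
  have hd1 : ((d : ℤ) : ZMod p) = 1 := by
    have h' := congrArg PowerSeries.constantCoeff hvd
    rwa [hv0, map_intCast, eq_comm] at h'
  apply hv
  rw [hvd, ← map_intCast (PowerSeries.C (R := ZMod p)) d, hd1, map_one]

/-- **Two-term factor**: `c̄ n̄₁ − n̄₂ u ≠ 0` in `𝔽_p⟦T⟧` for `u` with constant coefficient `1`, `u ≠ 1`, `c̄ ≠ 0`, unless
`n̄₁ = n̄₂ = 0`: constant coefficients give `n̄₂ = c̄ n̄₁`, then `n̄₂ (u − 1) = 0` in a domain.
[cite: Kato2004Asterisque, Lemma 13.10 (1) (p. 230)] [cite: Washington1997, §7.2, §13.1] -/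
theorem twoTermFactor_ne_zero {u : PowerSeries (ZMod p)} (hu0 : PowerSeries.constantCoeff u = 1) (hu : u ≠ 1)
    {c n₁ n₂ : ℤ} (hc : ((c : ℤ) : ZMod p) ≠ 0) (hn : ¬ (((n₁ : ℤ) : ZMod p) = 0 ∧ ((n₂ : ℤ) : ZMod p) = 0)) :
    (c : PowerSeries (ZMod p)) * (n₁ : PowerSeries (ZMod p)) - (n₂ : PowerSeries (ZMod p)) * u ≠ 0 := by
  intro h
  have heq : (n₂ : PowerSeries (ZMod p)) * u = (c : PowerSeries (ZMod p)) * (n₁ : PowerSeries (ZMod p)) :=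
    (sub_eq_zero.mp h).symm
  -- constant coefficients: `n̄₂ = c̄ n̄₁`
  have h0 : ((n₂ : ℤ) : ZMod p) = ((c : ℤ) : ZMod p) * ((n₁ : ℤ) : ZMod p) := by
    have h' := congrArg PowerSeries.constantCoeff heq
    rwa [map_mul, map_mul, map_intCast, map_intCast, map_intCast, hu0, mul_one] at h'
  by_cases hn₂ : ((n₂ : ℤ) : ZMod p) = 0
  · -- then `c̄ n̄₁ = 0`, so `n̄₁ = 0`: excluded
    have hn₁ : ((n₁ : ℤ) : ZMod p) = 0 := by
      rw [hn₂, eq_comm, mul_eq_zero] at h0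
      exact h0.resolve_left hc
    exact hn ⟨hn₁, hn₂⟩
  · -- `n̄₂ u = n̄₂`, so `u = 1`
    have hC : (n₂ : PowerSeries (ZMod p)) * u = (n₂ : PowerSeries (ZMod p)) := by
      rw [heq, ← map_intCast (PowerSeries.C (R := ZMod p)) c, ← map_intCast (PowerSeries.C (R := ZMod p)) n₁,
        ← map_intCast (PowerSeries.C (R := ZMod p)) n₂, ← map_mul, ← h0]
    have hn₂C : (n₂ : PowerSeries (ZMod p)) ≠ 0 := by
      rw [← map_intCast (PowerSeries.C (R := ZMod p)) n₂]
      intro h0'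
      apply hn₂
      have := congrArg PowerSeries.constantCoeff h0'
      rwa [PowerSeries.constantCoeff_C, map_zero] at this
    apply hu
    have h1 : (n₂ : PowerSeries (ZMod p)) * (u - 1) = 0 := by rw [mul_sub, mul_one, hC, sub_self]
    exact sub_eq_zero.mp ((mul_eq_zero.mp h1).resolve_left hn₂C)

/-- **Kato's Euler factor mod `p` does not vanish**: in `𝔽_p⟦T⟧`, for `w` with constant coefficient `1`, `w ≠ 1` (the image of
`Ψ_ℓ`, `κ(σ_ℓ) ≠ 0`) and `ℓ̄ ≠ 0` (`ℓ ≠ p`): `ℓ̄² w² − (ā ℓ̄) w + ε̄ ℓ̄ ≠ 0` — with `w = 1 + δ`, `δ ≠ 0`, `δ ≡ 0 (mod T)`, it equals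
`(ℓ̄² − āℓ̄ + ε̄ℓ̄) + δ((2ℓ̄² − āℓ̄) + ℓ̄²δ)`; reading constant coefficients twice leaves `ℓ̄² δ = 0`.  NO hypothesis on the
Dirichlet coefficient `a_ℓ` or on `ε_ℓ`. [cite: Kato2004Asterisque, §13.9 (p. 229), Ex. 13.3 (p. 225)] [cite: Washington1997, §7.2] -/
theorem eulerFactor_ne_zero {w : PowerSeries (ZMod p)} (hw0 : PowerSeries.constantCoeff w = 1) (hw : w ≠ 1)
    {ℓ : ℕ} (hℓ : ((ℓ : ℕ) : ZMod p) ≠ 0) (a e : ℤ) :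
    ((ℓ ^ 2 : ℕ) : PowerSeries (ZMod p)) * w ^ 2 - ((a * ℓ : ℤ) : PowerSeries (ZMod p)) * w +
      ((e * ℓ : ℤ) : PowerSeries (ZMod p)) ≠ 0 := by
  set δ : PowerSeries (ZMod p) := w - 1 with hδ
  have hδ0 : δ ≠ 0 := fun h => hw (sub_eq_zero.mp h)
  have hδc : PowerSeries.constantCoeff δ = 0 := by rw [hδ, map_sub, hw0, map_one, sub_self]
  have hw1 : w = 1 + δ := by rw [hδ]; ring
  -- name the three constants
  set L : PowerSeries (ZMod p) := PowerSeries.C (((ℓ : ℕ) : ZMod p) ^ 2) with hL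
  set A : PowerSeries (ZMod p) := PowerSeries.C (((a : ℤ) : ZMod p) * ((ℓ : ℕ) : ZMod p)) with hA
  set B : PowerSeries (ZMod p) := PowerSeries.C (((e : ℤ) : ZMod p) * ((ℓ : ℕ) : ZMod p)) with hB
  have hLc : ((ℓ ^ 2 : ℕ) : PowerSeries (ZMod p)) = L := by
    rw [hL, map_pow, map_natCast, Nat.cast_pow]
  have hAc : ((a * ℓ : ℤ) : PowerSeries (ZMod p)) = A := by
    rw [hA, map_mul, map_intCast, map_natCast]; push_cast; ring
  have hBc : ((e * ℓ : ℤ) : PowerSeries (ZMod p)) = B := by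
    rw [hB, map_mul, map_intCast, map_natCast]; push_cast; ring
  rw [hLc, hAc, hBc, hw1]
  have hG : L * (1 + δ) ^ 2 - A * (1 + δ) + B = (L - A + B) + δ * ((2 * L - A) + L * δ) := by ring
  rw [hG]
  intro h
  -- constant coefficients: `ℓ̄² − āℓ̄ + ε̄ℓ̄ = 0`
  have h0 : PowerSeries.constantCoeff (L - A + B) = 0 := by
    have h' := congrArg PowerSeries.constantCoeff h
    rwa [map_add, map_mul, hδc, zero_mul, add_zero, map_zero] at h'
  have hconst : L - A + B = 0 := by
    rw [hL, hA, hB, ← map_sub, ← map_add] at h0 ⊢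
    rw [PowerSeries.constantCoeff_C] at h0
    rw [h0, map_zero]
  rw [hconst, zero_add] at h
  have h1 : (2 * L - A) + L * δ = 0 := (mul_eq_zero.mp h).resolve_left hδ0
  -- constant coefficients again: `2ℓ̄² − āℓ̄ = 0`
  have h1c : PowerSeries.constantCoeff (2 * L - A) = 0 := by
    have h' := congrArg PowerSeries.constantCoeff h1
    rwa [map_add, map_mul, hδc, mul_zero, add_zero, map_zero] at h'
  have hlin : 2 * L - A = 0 := by
    rw [hL, hA, ← map_ofNat (PowerSeries.C (R := ZMod p)) 2, ← map_mul, ← map_sub] at h1c ⊢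
    rw [PowerSeries.constantCoeff_C] at h1c
    rw [h1c, map_zero]
  rw [hlin, zero_add] at h1
  -- `ℓ̄² δ = 0` with `δ ≠ 0`: so `ℓ̄² = 0`, contradiction
  have hL0 : L = 0 := (mul_eq_zero.mp h1).resolve_right hδ0
  have hℓ2 : ((ℓ : ℕ) : ZMod p) ^ 2 = 0 := by
    have h' := congrArg PowerSeries.constantCoeff hL0
    rwa [hL, PowerSeries.constantCoeff_C, map_zero] at h'
  exact hℓ (pow_eq_zero_iff (n := 2) two_ne_zero |>.mp hℓ2)

end Factors

/-! ## §0.3 `p ∤ M̃` in the semi-diagonal and diagonal gauges (any prime `p`; no hypothesis on `a_ℓ, ε_ℓ`) -/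

section Multiplier

/-- **`p ∤ M̃` in the SEMI-DIAGONAL gauge `n₃ = n₁, n₄ = n₂` (`d′ = 1`).** For integers `c, d` prime to `p`, cusp coordinates
with NOT (`p ∣ n₁` and `p ∣ n₂`), exponents `x, y ≠ 0` of `Ψ_c = (1+T)^x`, `Ψ_d = (1+T)^y`, and a finite set `E` of naturals
prime to `p` with exponents `e ℓ ≠ 0`: the four-cusp factor reduces in `𝔽_p⟦T⟧` to `c̄ d̄ (d̄ − v)(c̄ n̄₁ − n̄₂ u)` and each Euler
factor to `ℓ̄²w² − āℓ̄w + ε̄ℓ̄`, none of which vanishes (§2); so `C p ∤ katoMultiplier p c d n₁ n₂ n₁ n₂ …`.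
[cite: Kato2004Asterisque, Thm. 6.6 (1) (p. 163), Lemma 13.10 (1) (p. 230), §13.12 (p. 231)] [cite: Washington1997, §13.1] -/
theorem not_C_p_dvd_katoMultiplier_semidiag {c d : ℤ} (hc : ¬ (p : ℤ) ∣ c) (hd : ¬ (p : ℤ) ∣ d) {n₁ n₂ : ℤ}
    (hn : ¬ ((p : ℤ) ∣ n₁ ∧ (p : ℤ) ∣ n₂)) {x y : ℤ_[p]} (hx : x ≠ 0) (hy : y ≠ 0)
    (E : Finset ℕ) (aℓ εℓ : ℕ → ℤ) {e : ℕ → ℤ_[p]} (hE : ∀ ℓ ∈ E, ¬ (p ∣ ℓ) ∧ e ℓ ≠ 0) :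
    ¬ (PowerSeries.C (p : ℤ_[p]) : IwasawaAlgebra p) ∣
      katoMultiplier p c d n₁ n₂ n₁ n₂ (onePlusTPow p ℤ_[p] x : IwasawaAlgebra p)
        (onePlusTPow p ℤ_[p] y : IwasawaAlgebra p) E aℓ εℓ
        (fun ℓ => (onePlusTPow p ℤ_[p] (e ℓ) : IwasawaAlgebra p)) := by
  rw [C_p_dvd_iff_map_toZMod_eq_zero]
  have hcz : ((c : ℤ) : ZMod p) ≠ 0 := fun h => hc ((ZMod.intCast_zmod_eq_zero_iff_dvd c p).mp h)
  have hdz : ((d : ℤ) : ZMod p) ≠ 0 := fun h => hd ((ZMod.intCast_zmod_eq_zero_iff_dvd d p).mp h)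
  have hnz : ¬ (((n₁ : ℤ) : ZMod p) = 0 ∧ ((n₂ : ℤ) : ZMod p) = 0) := fun h =>
    hn ⟨(ZMod.intCast_zmod_eq_zero_iff_dvd n₁ p).mp h.1, (ZMod.intCast_zmod_eq_zero_iff_dvd n₂ p).mp h.2⟩
  have hcC : (c : PowerSeries (ZMod p)) ≠ 0 := by
    rw [← map_intCast (PowerSeries.C (R := ZMod p)) c]
    intro h; apply hcz
    have := congrArg PowerSeries.constantCoeff h
    rwa [PowerSeries.constantCoeff_C, map_zero] at this
  have hdC : (d : PowerSeries (ZMod p)) ≠ 0 := by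
    rw [← map_intCast (PowerSeries.C (R := ZMod p)) d]
    intro h; apply hdz
    have := congrArg PowerSeries.constantCoeff h
    rwa [PowerSeries.constantCoeff_C, map_zero] at this
  set u := PowerSeries.map (PadicInt.toZMod (p := p)) (onePlusTPow p ℤ_[p] x : IwasawaAlgebra p) with hu
  set v := PowerSeries.map (PadicInt.toZMod (p := p)) (onePlusTPow p ℤ_[p] y : IwasawaAlgebra p) with hv
  unfold katoMultiplier
  rw [map_mul]
  refine mul_ne_zero ?_ ?_
  · -- the four-cusp factor: `c̄ d̄ (d̄ − v)(c̄ n̄₁ − n̄₂ u)`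
    rw [map_add, map_sub, map_sub, map_mul, map_mul, map_mul, map_mul, map_intCast, map_intCast, map_intCast,
      map_intCast, ← hu, ← hv]
    have key : ((c ^ 2 * d ^ 2 * n₁ : ℤ) : PowerSeries (ZMod p)) - ((c * d ^ 2 * n₂ : ℤ) : PowerSeries (ZMod p)) * u -
        ((c ^ 2 * d * n₁ : ℤ) : PowerSeries (ZMod p)) * v + ((c * d * n₂ : ℤ) : PowerSeries (ZMod p)) * u * v =
        ((c : PowerSeries (ZMod p)) * (d : PowerSeries (ZMod p))) *
          (((d : PowerSeries (ZMod p)) - v) *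
            ((c : PowerSeries (ZMod p)) * (n₁ : PowerSeries (ZMod p)) - (n₂ : PowerSeries (ZMod p)) * u)) := by
      push_cast; ring
    rw [key]
    exact mul_ne_zero (mul_ne_zero hcC hdC)
      (mul_ne_zero (linearFactor_ne_zero (constantCoeff_map_onePlusTPow y) (map_onePlusTPow_ne_one hy) d)
        (twoTermFactor_ne_zero (constantCoeff_map_onePlusTPow x) (map_onePlusTPow_ne_one hx) hcz hnz))
  · -- each Euler factor: `ℓ̄² w² − ā ℓ̄ w + ε̄ ℓ̄`
    rw [map_prod, Finset.prod_ne_zero_iff]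
    intro ℓ hℓ
    obtain ⟨hpℓ, heℓ⟩ := hE ℓ hℓ
    have hℓz : ((ℓ : ℕ) : ZMod p) ≠ 0 := fun h => hpℓ ((ZMod.natCast_eq_zero_iff ℓ p).mp h)
    rw [map_add, map_sub, map_mul, map_mul, map_pow, map_natCast, map_intCast, map_intCast]
    exact eulerFactor_ne_zero (constantCoeff_map_onePlusTPow (e ℓ)) (map_onePlusTPow_ne_one heℓ) hℓz (aℓ ℓ) (εℓ ℓ)

/-- **`p ∤ M̃` in the DIAGONAL gauge `n₁ = n₂ = n₃ = n₄ = n`** (`c ≡ d₁ ≡ 1 (mod A)`, `d′ = 1`): the case `p ∤ n` of the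
semi-diagonal theorem; the four-cusp factor is `n·c d (c − Ψ_c)(d − Ψ_d)`.
[cite: Kato2004Asterisque, Lemma 13.10 (1) (p. 230), §13.12 (p. 231)] -/
theorem not_C_p_dvd_katoMultiplier_diag {c d : ℤ} (hc : ¬ (p : ℤ) ∣ c) (hd : ¬ (p : ℤ) ∣ d) {n : ℤ}
    (hn : ¬ (p : ℤ) ∣ n) {x y : ℤ_[p]} (hx : x ≠ 0) (hy : y ≠ 0)
    (E : Finset ℕ) (aℓ εℓ : ℕ → ℤ) {e : ℕ → ℤ_[p]} (hE : ∀ ℓ ∈ E, ¬ (p ∣ ℓ) ∧ e ℓ ≠ 0) :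
    ¬ (PowerSeries.C (p : ℤ_[p]) : IwasawaAlgebra p) ∣
      katoMultiplier p c d n n n n (onePlusTPow p ℤ_[p] x : IwasawaAlgebra p)
        (onePlusTPow p ℤ_[p] y : IwasawaAlgebra p) E aℓ εℓ
        (fun ℓ => (onePlusTPow p ℤ_[p] (e ℓ) : IwasawaAlgebra p)) :=
  not_C_p_dvd_katoMultiplier_semidiag hc hd (fun h => hn h.1) hx hy E aℓ εℓ hE

/-- Currency `M̃ ∉ (p) = IwasawaAlgebra.augIdealP p` (semi-diagonal gauge). [cite: Kato2004Asterisque, §13.12 (p. 231)] -/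
theorem katoMultiplier_semidiag_not_mem_augIdealP {c d : ℤ} (hc : ¬ (p : ℤ) ∣ c) (hd : ¬ (p : ℤ) ∣ d) {n₁ n₂ : ℤ}
    (hn : ¬ ((p : ℤ) ∣ n₁ ∧ (p : ℤ) ∣ n₂)) {x y : ℤ_[p]} (hx : x ≠ 0) (hy : y ≠ 0)
    (E : Finset ℕ) (aℓ εℓ : ℕ → ℤ) {e : ℕ → ℤ_[p]} (hE : ∀ ℓ ∈ E, ¬ (p ∣ ℓ) ∧ e ℓ ≠ 0) :
    katoMultiplier p c d n₁ n₂ n₁ n₂ (onePlusTPow p ℤ_[p] x : IwasawaAlgebra p)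
        (onePlusTPow p ℤ_[p] y : IwasawaAlgebra p) E aℓ εℓ
        (fun ℓ => (onePlusTPow p ℤ_[p] (e ℓ) : IwasawaAlgebra p)) ∉ IwasawaAlgebra.augIdealP p := by
  rw [IwasawaAlgebra.augIdealP, Ideal.mem_span_singleton]
  exact not_C_p_dvd_katoMultiplier_semidiag hc hd hn hx hy E aℓ εℓ hE

end Multiplier

/-! ## §0.4 Exponents from the cyclotomic tower, and the `Ψ`-keyed theorem in the letter of the body -/

section Cyclotomic

/-- **In the CYCLOTOMIC `ℤ_p`-extension, `σ` with `χ_cyc(σ) = c ∈ ℤ`, `c ≠ ±1`, has `κ(σ) ≠ 0`.**  `κ(σ) = 0` means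
`σ ∈ ker κ = χ_cyc⁻¹(μ(ℤ_p))` (`ZpExtension.IsCyclotomic`), so `c^m = 1` in `ℤ_p`, hence in `ℤ`, for some `m ≥ 1`: `c = ±1`.
[cite: Washington1997, §13.1 (p. 264)] [cite: GreenbergLNM1716, §1] -/
theorem toAdd_ne_zero_of_isCyclotomic {K : ZpExtension ℚ p} (hK : K.IsCyclotomic) {σ : absoluteGaloisGroup ℚ} {c : ℤ}
    (hσ : ((GaloisRep.cyclotomicCharacter ℚ p σ : ℤ_[p]ˣ) : ℤ_[p]) = c) (h1 : c ≠ 1) (h1' : c ≠ -1) :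
    (K σ).toAdd ≠ 0 := by
  intro h0
  have hker : σ ∈ K.kerSubgroup := by
    rw [ZpExtension.mem_kerSubgroup, ← ofAdd_toAdd (K σ), h0, ofAdd_zero]
  rw [hK, Subgroup.mem_comap, CommGroup.mem_torsion, isOfFinOrder_iff_pow_eq_one] at hker
  obtain ⟨m, hm, hpow⟩ := hker
  have hpow₁ : (GaloisRep.cyclotomicCharacter ℚ p σ : ℤ_[p]ˣ) ^ m = 1 := hpow
  have hpow' : ((GaloisRep.cyclotomicCharacter ℚ p σ : ℤ_[p]ˣ) : ℤ_[p]) ^ m = 1 := by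
    rw [← Units.val_pow_eq_pow_val, hpow₁, Units.val_one]
  rw [hσ] at hpow'
  have hcm : c ^ m = 1 := by exact_mod_cast hpow'
  rcases Int.isUnit_iff.mp (IsUnit.of_pow_eq_one hcm hm.ne') with h | h
  exacts [h1 h, h1' h]

/-- For a prime `ℓ ≠ p` and `σ` with `χ_cyc(σ) = ℓ` in the cyclotomic tower: `κ(σ) ≠ 0` (`ℓ ≠ ±1`).
[cite: Washington1997, §13.1 (p. 264)] -/
theorem toAdd_ne_zero_of_isCyclotomic_prime {K : ZpExtension ℚ p} (hK : K.IsCyclotomic) {σ : absoluteGaloisGroup ℚ}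
    {ℓ : ℕ} (hℓ : ℓ.Prime) (hσ : ((GaloisRep.cyclotomicCharacter ℚ p σ : ℤ_[p]ˣ) : ℤ_[p]) = ℓ) :
    (K σ).toAdd ≠ 0 := by
  refine toAdd_ne_zero_of_isCyclotomic hK (c := (ℓ : ℤ)) (by rw [hσ, Int.cast_natCast]) ?_ ?_
  · exact_mod_cast hℓ.ne_one
  · have : (0 : ℤ) ≤ (ℓ : ℤ) := Int.natCast_nonneg ℓ
    omega

/-- **The `Ψ`-KEYED theorem in the letter of the μ-free clause of `HasMuFreeRealisedZetaFamilyBody`** (semi-diagonal gauge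
`n₃ = n₁, n₄ = n₂`): for the cyclotomic `ℤ_p`-extension `K`, Galois elements with `χ_cyc(σ_c) = c`, `χ_cyc(σ_{d₁}) = d₁`,
`χ_cyc(σ_ℓ) = ℓ` on `A.primeFactors.erase p`, integers `c, d₁ ∉ pℤ ∪ {±1}`, and NOT (`p ∣ n₁ ∧ p ∣ n₂`):
`¬ (p : Λ) ∣ katoMultiplier p c d₁ n₁ n₂ n₁ n₂ Ψ(σ_c) Ψ(σ_{d₁}) (A.primeFactors.erase p) a_• ε_• Ψ(σ_•)` — for ANY `a_•, ε_•`.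
[cite: Kato2004Asterisque, Lemma 13.10 (1) (p. 230), §13.12 (p. 231)] [cite: Castella2018, §2.1–2.2 (pp. 4–5)] -/
theorem not_natCast_dvd_katoMultiplier_psi_of_isCyclotomic (K : ZpExtension ℚ p) (hK : K.IsCyclotomic)
    {c d₁ : ℤ} (hc : ¬ (p : ℤ) ∣ c) (hd : ¬ (p : ℤ) ∣ d₁) (hc1 : c ≠ 1) (hc1' : c ≠ -1) (hd1 : d₁ ≠ 1) (hd1' : d₁ ≠ -1)
    {n₁ n₂ : ℤ} (hn : ¬ ((p : ℤ) ∣ n₁ ∧ (p : ℤ) ∣ n₂))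
    {σc σd : absoluteGaloisGroup ℚ} {σℓ : ℕ → absoluteGaloisGroup ℚ}
    (hσc : ((GaloisRep.cyclotomicCharacter ℚ p σc : ℤ_[p]ˣ) : ℤ_[p]) = c)
    (hσd : ((GaloisRep.cyclotomicCharacter ℚ p σd : ℤ_[p]ˣ) : ℤ_[p]) = d₁) {A : ℕ}
    (hσℓ : ∀ ℓ ∈ A.primeFactors.erase p, ((GaloisRep.cyclotomicCharacter ℚ p (σℓ ℓ) : ℤ_[p]ˣ) : ℤ_[p]) = ℓ)
    (aℓ εℓ : ℕ → ℤ) :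
    ¬ ((p : IwasawaAlgebra p) ∣
      katoMultiplier p c d₁ n₁ n₂ n₁ n₂
        ((IwasawaCharacter.Psi p ℤ_[p] K σc : (PowerSeries ℤ_[p])ˣ) : IwasawaAlgebra p)
        ((IwasawaCharacter.Psi p ℤ_[p] K σd : (PowerSeries ℤ_[p])ˣ) : IwasawaAlgebra p)
        (A.primeFactors.erase p) aℓ εℓ
        (fun ℓ => ((IwasawaCharacter.Psi p ℤ_[p] K (σℓ ℓ) : (PowerSeries ℤ_[p])ˣ) : IwasawaAlgebra p))) := by
  rw [natCast_dvd_iff_C_dvd]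
  simp only [IwasawaCharacter.Psi_apply]
  refine not_C_p_dvd_katoMultiplier_semidiag hc hd hn (toAdd_ne_zero_of_isCyclotomic hK hσc hc1 hc1')
    (toAdd_ne_zero_of_isCyclotomic hK hσd hd1 hd1') (A.primeFactors.erase p) aℓ εℓ (e := fun ℓ => (K (σℓ ℓ)).toAdd) ?_
  intro ℓ hℓ
  have hℓp : ℓ ≠ p := Finset.ne_of_mem_erase hℓ
  have hℓprime : ℓ.Prime := Nat.prime_of_mem_primeFactors (Finset.mem_of_mem_erase hℓ)
  refine ⟨fun hdvd => hℓp ((Nat.prime_dvd_prime_iff_eq hp.out hℓprime).mp hdvd).symm, ?_⟩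
  exact toAdd_ne_zero_of_isCyclotomic_prime hK hℓprime (hσℓ ℓ hℓ)

end Cyclotomic

/-! ## §0.5 The symbol side: a `p`-primitive minus symbol exists, and the diagonal gauge is admissible -/

section Symbols

variable {N : ℕ} (f : CuspForm (Gamma0 N) 2)

/-- **Some minus symbol is `p`-PRIMITIVE in the Manin lattice.**  If the rational minus symbols `[r]⁻_f` generate `ℤ·q⁻`
(`0 < q⁻`; the body's clause `AddSubgroup.closure (Set.range (ratMinusSymbol f)) = AddSubgroup.zmultiples qm`), then some
`[a/A]⁻_f = n·q⁻` with `p ∤ n` (else every symbol lies in `ℤ·pq⁻ ⊊ ℤ·q⁻`). [cite: Manin1972, Thm. 1.6 and Cor. 3.6]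
[cite: MazurTateTeitelbaum1986Invent, §I.8] -/
theorem exists_ratMinusSymbol_not_dvd {qm : ℚ} (hqm : 0 < qm)
    (hspan : AddSubgroup.closure (Set.range (ratMinusSymbol f)) = AddSubgroup.zmultiples qm) :
    ∃ (a : ℤ) (A : ℕ) (n : ℤ), 0 < A ∧ ratMinusSymbol f ((a : ℚ) / A) = n * qm ∧ ¬ (p : ℤ) ∣ n := by
  by_contra H
  push Not at H
  -- every symbol lies in `ℤ · (p qm)`
  have hsub : Set.range (ratMinusSymbol f) ⊆ (AddSubgroup.zmultiples ((p : ℚ) * qm) : Set ℚ) := by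
    rintro _ ⟨r, rfl⟩
    have hmem : ratMinusSymbol f r ∈ AddSubgroup.zmultiples qm := by
      rw [← hspan]; exact AddSubgroup.subset_closure ⟨r, rfl⟩
    obtain ⟨k, hk⟩ := AddSubgroup.mem_zmultiples_iff.mp hmem
    have hr : ratMinusSymbol f ((r.num : ℚ) / r.den) = k * qm := by
      rw [Rat.num_div_den r, ← hk, zsmul_eq_mul]
    obtain ⟨k', hk'⟩ := H r.num r.den k r.den_pos hr
    refine AddSubgroup.mem_zmultiples_iff.mpr ⟨k', ?_⟩
    rw [← hk, hk', zsmul_eq_mul, zsmul_eq_mul]; push_cast; ring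
  have hle : AddSubgroup.zmultiples qm ≤ AddSubgroup.zmultiples ((p : ℚ) * qm) := by
    rw [← hspan]; exact (AddSubgroup.closure_le _).mpr hsub
  have hqmem : qm ∈ AddSubgroup.zmultiples ((p : ℚ) * qm) := hle (AddSubgroup.mem_zmultiples qm)
  obtain ⟨k, hk⟩ := AddSubgroup.mem_zmultiples_iff.mp hqmem
  rw [zsmul_eq_mul] at hk
  -- `k p qm = qm` with `qm ≠ 0`: `k p = 1` in `ℤ`, impossible for a prime `p`
  have hkp : (k : ℚ) * p = 1 := by
    have h := hk
    rw [← mul_assoc] at h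
    exact mul_right_cancel₀ hqm.ne' (by rw [h, one_mul])
  have hkp' : k * (p : ℤ) = 1 := by exact_mod_cast hkp
  have hdvd : (p : ℤ) ∣ 1 := ⟨k, by rw [mul_comm, hkp']⟩
  exact hp.out.ne_one (Nat.dvd_one.mp (by exact_mod_cast hdvd))

/-- In the gauge `c ≡ 1 (mod A)`: `[a c/A]⁻ = [a/A]⁻` (periodicity `ratMinusSymbol_add_intCast`).
[cite: MazurTateTeitelbaum1986Invent, §I.4 (4.2)] -/
theorem ratMinusSymbol_mul_div_of_modEq_one [NeZero N] {A : ℕ} (hA : 0 < A) {c : ℤ} (hc : (A : ℤ) ∣ c - 1) (a : ℤ) :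
    ratMinusSymbol f ((a * c : ℚ) / A) = ratMinusSymbol f ((a : ℚ) / A) := by
  obtain ⟨k, hk⟩ := hc
  have hA' : (A : ℚ) ≠ 0 := by exact_mod_cast hA.ne'
  have hc' : (c : ℚ) = 1 + (A : ℚ) * k := by
    have : (c : ℤ) = 1 + (A : ℤ) * k := by omega
    exact_mod_cast this
  have : ((a * c : ℚ) / A) = (a : ℚ) / A + ((a * k : ℤ) : ℚ) := by
    rw [hc', div_add' _ _ _ hA']
    push_cast
    congr 1
    ring
  rw [this, ratMinusSymbol_add_intCast]

/-- In the gauge `c ≡ 1 (mod A)`, `d′ = 1`: the rational four-cusp factor is `[a/A]⁻ · c d (c − 1)(d − 1)`.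
[cite: Kato2004Asterisque, Thm. 6.6 (1) (p. 163), Lemma 13.10 (1) (p. 230)] -/
theorem ratCuspFactor_diag [NeZero N] {A : ℕ} (hA : 0 < A) {c : ℤ} (hc : (A : ℤ) ∣ c - 1) (d a : ℤ) :
    ratCuspFactor f true c d a A 1 =
      ratMinusSymbol f ((a : ℚ) / A) * ((c : ℚ) * d * (c - 1) * (d - 1)) := by
  have h2 := ratMinusSymbol_mul_div_of_modEq_one f hA hc a
  have h3 : ratMinusSymbol f ((a * (1 : ℤ) : ℚ) / A) = ratMinusSymbol f ((a : ℚ) / A) := by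
    rw [Int.cast_one, mul_one]
  have h4 : ratMinusSymbol f ((a * c * (1 : ℤ) : ℚ) / A) = ratMinusSymbol f ((a : ℚ) / A) := by
    rw [Int.cast_one, mul_one]; exact h2
  simp only [ratCuspFactor, ↓reduceIte]
  rw [h2, h3, h4]
  ring

/-- **ADMISSIBLE DIAGONAL-GAUGE PARAMETERS.**  For a prime `p`, a level `N ≠ 0`, a form `f` whose minus symbols generate
`ℤ·q⁻` (`0 < q⁻`): the parameters `(c, d₁, a, A, d′) = (1 + 6pA, 1 + 6pNA, a, A, 1)` — with `[a/A]⁻ = n q⁻`, `p ∤ n` from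
`exists_ratMinusSymbol_not_dvd` — satisfy EVERY guard of clause (A3) of `HasMuFreeRealisedZetaFamilyBody` (`0 < A`,
`gcd(c, 6pA) = 1`, `gcd(d₁, 6pN) = 1`, `d₁ d′ ≡ 1 (mod A)`, `R⁻ = ratCuspFactor f true c d₁ a A d′ ≠ 0`), the four symbol
equations of clause (A5′) at ONE coordinate `n₁ = n₂ = n₃ = n₄ = n`, the hypotheses of §3–§4 (`p ∤ n`, `p ∤ c`, `p ∤ d₁`,
`c, d₁ ≠ ±1`), and the (C5) guard of `ZetaBody` at every `p`-power level (`gcd(c d₁, p^k A) = 1`; tame levels are prime to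
`c d₁` by `badPlaces`). [cite: Kato2004Asterisque, §13.9 (p. 229), Lemma 13.10 (1) (p. 230), §13.12 (p. 231)]
[cite: MazurTateTeitelbaum1986Invent, §I.4 (4.2), §I.8] -/
theorem exists_diagonalGauge [NeZero N] {qm : ℚ} (hqm : 0 < qm)
    (hspan : AddSubgroup.closure (Set.range (ratMinusSymbol f)) = AddSubgroup.zmultiples qm) :
    ∃ (c d₁ a : ℤ) (A : ℕ) (d' : ℤ) (n : ℤ),
      0 < A ∧ Int.gcd c (6 * p * A) = 1 ∧ Int.gcd d₁ (6 * p * N) = 1 ∧ (d₁ : ℤ) * d' ≡ 1 [ZMOD (A : ℤ)] ∧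
      ratCuspFactor f true c d₁ a A d' ≠ 0 ∧
      ratMinusSymbol f ((a : ℚ) / A) = n * qm ∧ ratMinusSymbol f ((a * c : ℚ) / A) = n * qm ∧
      ratMinusSymbol f ((a * d' : ℚ) / A) = n * qm ∧ ratMinusSymbol f ((a * c * d' : ℚ) / A) = n * qm ∧
      ¬ (p : ℤ) ∣ n ∧ ¬ (p : ℤ) ∣ c ∧ ¬ (p : ℤ) ∣ d₁ ∧ c ≠ 1 ∧ c ≠ -1 ∧ d₁ ≠ 1 ∧ d₁ ≠ -1 ∧
      (∀ k : ℕ, Int.gcd (c * d₁) (p ^ k * A) = 1) := by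
  obtain ⟨a, A, n, hA, hn, hpn⟩ := exists_ratMinusSymbol_not_dvd (p := p) f hqm hspan
  have hN : 0 < N := Nat.pos_of_ne_zero (NeZero.ne N)
  have hp1 : 1 < p := hp.out.one_lt
  set c : ℤ := 1 + 6 * p * A with hcdef
  set d₁ : ℤ := 1 + 6 * p * N * A with hddef
  have hpos : (0 : ℤ) < 6 * p * A := by positivity
  have hposd : (0 : ℤ) < 6 * p * N * A := by positivity
  have hcA : (A : ℤ) ∣ c - 1 := ⟨6 * p, by rw [hcdef]; ring⟩
  have hpc : ¬ (p : ℤ) ∣ c := by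
    rw [hcdef, dvd_add_left (⟨6 * A, by ring⟩ : (p : ℤ) ∣ 6 * p * A)]
    intro h
    exact hp.out.ne_one (Nat.dvd_one.mp (by exact_mod_cast h))
  have hpd : ¬ (p : ℤ) ∣ d₁ := by
    rw [hddef, dvd_add_left (⟨6 * N * A, by ring⟩ : (p : ℤ) ∣ 6 * p * N * A)]
    intro h
    exact hp.out.ne_one (Nat.dvd_one.mp (by exact_mod_cast h))
  have hn0 : n ≠ 0 := by rintro rfl; exact hpn (dvd_zero _)
  have h₁ : ratMinusSymbol f ((a : ℚ) / A) = n * qm := hn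
  have h₂ : ratMinusSymbol f ((a * c : ℚ) / A) = n * qm := by
    rw [ratMinusSymbol_mul_div_of_modEq_one f hA hcA a, h₁]
  -- the (C5) guard of `ZetaBody` at every `p`-power level: `gcd(c d₁, p^k A) = 1`
  have hC5 : ∀ k : ℕ, Int.gcd (c * d₁) (p ^ k * A) = 1 := by
    intro k
    have hcp : IsCoprime c (p : ℤ) := ⟨1, -(6 * A), by rw [hcdef]; ring⟩
    have hcA' : IsCoprime c (A : ℤ) := ⟨1, -(6 * p), by rw [hcdef]; ring⟩
    have hdp : IsCoprime d₁ (p : ℤ) := ⟨1, -(6 * N * A), by rw [hddef]; ring⟩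
    have hdA : IsCoprime d₁ (A : ℤ) := ⟨1, -(6 * p * N), by rw [hddef]; ring⟩
    exact Int.isCoprime_iff_gcd_eq_one.mp
      (IsCoprime.mul_left (hcp.pow_right.mul_right hcA') (hdp.pow_right.mul_right hdA))
  refine ⟨c, d₁, a, A, 1, n, hA, ?_, ?_, ?_, ?_, h₁, h₂, ?_, ?_, hpn, hpc, hpd, ?_, ?_, ?_, ?_, hC5⟩
  · -- `gcd(1 + 6pA, 6pA) = 1`
    exact Int.isCoprime_iff_gcd_eq_one.mp ⟨1, -1, by rw [hcdef]; ring⟩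
  · -- `gcd(1 + 6pNA, 6pN) = 1`
    exact Int.isCoprime_iff_gcd_eq_one.mp ⟨1, -(A : ℤ), by rw [hddef]; ring⟩
  · -- `d₁ · 1 ≡ 1 (mod A)`
    exact Int.modEq_iff_dvd.mpr ⟨-(6 * p * N), by rw [hddef]; ring⟩
  · -- `R⁻ ≠ 0`
    rw [ratCuspFactor_diag f hA hcA d₁ a, h₁]
    have hc0 : (c : ℚ) ≠ 0 := by exact_mod_cast (show c ≠ 0 by omega)
    have hd0 : (d₁ : ℚ) ≠ 0 := by exact_mod_cast (show d₁ ≠ 0 by omega)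
    have hc1 : (c : ℚ) - 1 ≠ 0 := by
      have : ((c - 1 : ℤ) : ℚ) ≠ 0 := by exact_mod_cast (show c - 1 ≠ 0 by omega)
      push_cast at this; exact this
    have hd1 : (d₁ : ℚ) - 1 ≠ 0 := by
      have : ((d₁ - 1 : ℤ) : ℚ) ≠ 0 := by exact_mod_cast (show d₁ - 1 ≠ 0 by omega)
      push_cast at this; exact this
    have hnq : (n : ℚ) * qm ≠ 0 := mul_ne_zero (by exact_mod_cast hn0) hqm.ne'
    exact mul_ne_zero hnq (mul_ne_zero (mul_ne_zero (mul_ne_zero hc0 hd0) hc1) hd1)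
  · -- `[a d′/A]⁻` with `d′ = 1`
    rw [Int.cast_one, mul_one, h₁]
  · -- `[a c d′/A]⁻` with `d′ = 1`
    rw [Int.cast_one, mul_one, h₂]
  · omega
  · omega
  · omega
  · omega

end Symbols

/-! ## §0.6 The μ-free conjunct of the body in the diagonal gauge -/

section Conjunct

/-- **The μ-FREE CONJUNCT of `HasMuFreeRealisedZetaFamilyBody` in the diagonal gauge, VERBATIM shape** (`n₁ n₁ n₁ n₁`, `E =
A.primeFactors.erase p`, `Ψ_b = Psi p ℤ_p K σ_b`, the Dirichlet data `fun ℓ => W.LFunction ℓ`, `fun ℓ => if ℓ ∣ N then 0 else 1`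
being two instances of the arbitrary `aℓ εℓ`): for the cyclotomic `K` and parameters as in `exists_diagonalGauge`.  So the (E2)
prover who realises the family (clauses (A0)–(A4), the period clause and `0 ≤ e`) at these parameters gets the μ-free clause for
free. [cite: Kato2004Asterisque, §13.12 (p. 231), §13.14 (p. 234)] -/
theorem muFree_conjunct_of_diagonalGauge (K : ZpExtension ℚ p) (hK : K.IsCyclotomic)
    {c d₁ n : ℤ} (hc : ¬ (p : ℤ) ∣ c) (hd : ¬ (p : ℤ) ∣ d₁) (hc1 : c ≠ 1) (hc1' : c ≠ -1) (hd1 : d₁ ≠ 1) (hd1' : d₁ ≠ -1)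
    (hn : ¬ (p : ℤ) ∣ n) {σc σd : absoluteGaloisGroup ℚ} {σℓ : ℕ → absoluteGaloisGroup ℚ}
    (hσc : ((GaloisRep.cyclotomicCharacter ℚ p σc : ℤ_[p]ˣ) : ℤ_[p]) = c)
    (hσd : ((GaloisRep.cyclotomicCharacter ℚ p σd : ℤ_[p]ˣ) : ℤ_[p]) = d₁) {A : ℕ}
    (hσℓ : ∀ ℓ ∈ A.primeFactors.erase p, ((GaloisRep.cyclotomicCharacter ℚ p (σℓ ℓ) : ℤ_[p]ˣ) : ℤ_[p]) = ℓ)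
    (aℓ εℓ : ℕ → ℤ) :
    ¬ ((p : IwasawaAlgebra p) ∣
      katoMultiplier p c d₁ n n n n
        ((IwasawaCharacter.Psi p ℤ_[p] K σc : (PowerSeries ℤ_[p])ˣ) : IwasawaAlgebra p)
        ((IwasawaCharacter.Psi p ℤ_[p] K σd : (PowerSeries ℤ_[p])ˣ) : IwasawaAlgebra p)
        (A.primeFactors.erase p) aℓ εℓ
        (fun ℓ => ((IwasawaCharacter.Psi p ℤ_[p] K (σℓ ℓ) : (PowerSeries ℤ_[p])ˣ) : IwasawaAlgebra p))) :=
  not_natCast_dvd_katoMultiplier_psi_of_isCyclotomic K hK hc hd hc1 hc1' hd1 hd1' (fun h => hn h.1) hσc hσd hσℓ aℓ εℓ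

/-- **μ-free ⟺ `Λ/M̃Λ` is `p`-torsion-free** (the printed form of §13.12's requirement on `μ`): in `Λ = ℤ_p⟦T⟧`, `p` prime,
`p ∤ M` implies `M ∣ p·x → M ∣ x`. [cite: Kato2004Asterisque, §13.12 (p. 231, «Λ/μΛ is p-torsion free»)] [cite: Washington1997, §13.1] -/
theorem dvd_of_dvd_natCast_mul {M x : IwasawaAlgebra p} (hM : ¬ (p : IwasawaAlgebra p) ∣ M)
    (h : M ∣ (p : IwasawaAlgebra p) * x) : M ∣ x := by
  have hprime := prime_natCast_iwasawaAlgebra p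
  obtain ⟨y, hy⟩ := h
  -- `p ∣ M y` and `p ∤ M`, so `p ∣ y`
  have hpy : (p : IwasawaAlgebra p) ∣ y := by
    have : (p : IwasawaAlgebra p) ∣ M * y := ⟨x, by rw [← hy]⟩
    exact (hprime.dvd_or_dvd this).resolve_left hM
  obtain ⟨z, rfl⟩ := hpy
  refine ⟨z, ?_⟩
  have hp0 : (p : IwasawaAlgebra p) ≠ 0 := hprime.ne_zero
  apply mul_left_cancel₀ hp0
  rw [hy]; ring

end Conjunct

end Summit.BirchSwinnertonDyer.BirchSwinnertonDyer.Cruxes.EllipticUnitValueSevenOfGZK.RealisationAssembly.G66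

end G66Inline

open scoped BigOperators NumberField TensorProduct Classical
open Field IsDedekindDomain NumberField CongruenceSubgroup ValuativeRel
open Literature.NumberTheory.GaloisRepresentations
open Literature.NumberTheory.GaloisRepresentations.PeriodRingData
open Literature.NumberTheory.GaloisRepresentations.IsNonarchimedeanLocalField
open Literature.NumberTheory.PAdicHodge
open Literature.NumberTheory.EllipticCurves Literature.NumberTheory.EllipticCurves.ModularForms
open Literature.NumberTheory.AdelicBaseChange Literature.NumberTheory.Automorphic
open Literature.NumberTheory.EllipticCurves.Kato2004
open Literature.NumberTheory.EllipticCurves.Kato2004.EulerSystemValues Rat.HeightOneSpectrum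
open WeierstrassCurve Summit.BirchSwinnertonDyer.Rank1Residual

namespace Summit.BirchSwinnertonDyer.BirchSwinnertonDyer.Cruxes.EllipticUnitValueSevenOfGZK.RealisationAssembly

/-! ## §1 The Manin minus lattice is cyclic with a positive generator (kernel; was the hypothesis field
`MultiplierInputs.closure_range_ratMinusSymbol`) -/

section ManinLattice

variable {N : ℕ} [NeZero N] (f : CuspForm (Gamma0 N) 2)

/-- **`ℤ·{[r]⁻_f : r ∈ ℚ} = ℤ·q⁻` with `q⁻ > 0`**, for a weight-2 newform on `Γ₀(N)` with rational coefficients: the minus symbols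
have a common denominator `D` (Manin–Drinfeld, tree `exists_forall_ratMinusSymbol_eq_div_of_maninDrinfeld` fed by the tree theorem
`exists_nsmul_modularSymbol_mem_periodLattice_holds`), so their span is a subgroup of the cyclic group `ℤ·(1/D)` — it meets
`(0, 1/D)` trivially, hence is cyclic (`AddSubgroup.cyclic_of_isolated_zero`) — and it is non-zero (`exists_ratMinusSymbol_ne_zero`,
Manin Thm. 1.6: `V_ℚ(f)⁻ ≠ 0`). [cite: Manin1972, Thm. 1.6 and Cor. 3.6] [cite: MazurTateTeitelbaum1986Invent, §I.8] -/
theorem exists_pos_closure_range_ratMinusSymbol (hf : IsNewform0 f) (hQ : coeffField f = ⊥) :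
    ∃ qm : ℚ, 0 < qm ∧ AddSubgroup.closure (Set.range (ratMinusSymbol f)) = AddSubgroup.zmultiples qm := by
  obtain ⟨D, hD, hden⟩ := exists_forall_ratMinusSymbol_eq_div_of_maninDrinfeld
    (exists_nsmul_modularSymbol_mem_periodLattice_holds f)
  set H := AddSubgroup.closure (Set.range (ratMinusSymbol f)) with hH
  have hD' : (0 : ℚ) < 1 / D := by positivity
  -- `H ≤ ℤ·(1/D)`
  have hle : H ≤ AddSubgroup.zmultiples ((1 : ℚ) / D) := by
    rw [hH, AddSubgroup.closure_le]
    rintro _ ⟨r, rfl⟩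
    obtain ⟨m, hm⟩ := hden r
    rw [SetLike.mem_coe, hm, AddSubgroup.mem_zmultiples_iff]
    exact ⟨m, by rw [zsmul_eq_mul]; ring⟩
  -- `H ∩ (0, 1/D) = ∅`
  have hdisj : Disjoint (H : Set ℚ) (Set.Ioo 0 ((1 : ℚ) / D)) := by
    rw [Set.disjoint_left]
    rintro x hx ⟨h0, h1⟩
    obtain ⟨m, hm⟩ := AddSubgroup.mem_zmultiples_iff.mp (hle hx)
    rw [zsmul_eq_mul] at hm
    rw [← hm] at h0 h1
    have hm0 : (0 : ℚ) < m := by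
      by_contra h
      push Not at h
      nlinarith [mul_nonneg (neg_nonneg.mpr h) hD'.le]
    have hm1 : (m : ℚ) < 1 := by
      by_contra h
      push Not at h
      nlinarith [mul_nonneg (sub_nonneg.mpr h) hD'.le]
    have h0' : (0 : ℤ) < m := by exact_mod_cast hm0
    have h1' : m < (1 : ℤ) := by exact_mod_cast hm1
    omega
  obtain ⟨b, hb⟩ := AddSubgroup.cyclic_of_isolated_zero hD' hdisj
  -- `b ≠ 0`: some minus symbol is non-zero
  obtain ⟨r, hr⟩ := exists_ratMinusSymbol_ne_zero f hf hQ
  have hrH : ratMinusSymbol f r ∈ H := AddSubgroup.subset_closure ⟨r, rfl⟩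
  have hb0 : b ≠ 0 := by
    rintro rfl
    rw [hb, AddSubgroup.mem_closure_singleton] at hrH
    obtain ⟨k, hk⟩ := hrH
    exact hr (by rw [← hk, smul_zero])
  refine ⟨|b|, abs_pos.mpr hb0, ?_⟩
  rw [hb, ← AddSubgroup.zmultiples_eq_closure]
  rcases abs_choice b with h | h <;> rw [h]
  rw [AddSubgroup.zmultiples_neg]

/-- The same for the newform of an elliptic curve `W/ℚ` (rational coefficients by `IsNewformOf.coeffField_eq_bot`).
[cite: Manin1972, Thm. 1.6 and Cor. 3.6] -/
theorem exists_pos_closure_range_ratMinusSymbol_of_isNewformOf {W : WeierstrassCurve ℚ} (hf : IsNewformOf W f) :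
    ∃ qm : ℚ, 0 < qm ∧ AddSubgroup.closure (Set.range (ratMinusSymbol f)) = AddSubgroup.zmultiples qm :=
  exists_pos_closure_range_ratMinusSymbol f hf.1 hf.coeffField_eq_bot

end ManinLattice

/-! ## §2 Galois elements with prescribed cyclotomic character (kernel, from `GaloisRep.cyclotomicCharacter_surjective`) -/

section Cyclotomic

variable (p : ℕ) [Fact p.Prime]

/-- An integer prime to `p` is a unit of `ℤ_p`. [folklore] -/
theorem isUnit_intCast_padicInt {c : ℤ} (hc : ¬ (p : ℤ) ∣ c) : IsUnit ((c : ℤ) : ℤ_[p]) := by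
  rw [PadicInt.isUnit_iff]
  exact le_antisymm (PadicInt.norm_le_one _) (not_lt.mp (mt (PadicInt.norm_int_lt_one_iff_dvd c).mp hc))

/-- **`χ_cyc` hits every integer prime to `p`**: there is `σ ∈ Γ_ℚ` with `χ_p(σ) = c` in `ℤ_p` (surjectivity of the cyclotomic
character over `ℚ`, tree `GaloisRep.cyclotomicCharacter_surjective` with `cyclotomic.irreducible_rat`). [cite: Washington1997, Ch. 14 (p. 321)] -/
theorem exists_cyclotomicCharacter_eq_intCast {c : ℤ} (hc : ¬ (p : ℤ) ∣ c) :
    ∃ σ : absoluteGaloisGroup ℚ, ((GaloisRep.cyclotomicCharacter ℚ p σ : ℤ_[p]ˣ) : ℤ_[p]) = c := by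
  obtain ⟨σ, hσ⟩ := GaloisRep.cyclotomicCharacter_surjective ℚ p
    (fun n hn => Polynomial.cyclotomic.irreducible_rat hn) (isUnit_intCast_padicInt p hc).unit
  exact ⟨σ, by rw [hσ, IsUnit.unit_spec]⟩

/-- … and every natural number prime to `p`. [cite: Washington1997, Ch. 14 (p. 321)] -/
theorem exists_cyclotomicCharacter_eq_natCast {ℓ : ℕ} (hℓ : ¬ p ∣ ℓ) :
    ∃ σ : absoluteGaloisGroup ℚ, ((GaloisRep.cyclotomicCharacter ℚ p σ : ℤ_[p]ˣ) : ℤ_[p]) = ℓ := by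
  obtain ⟨σ, hσ⟩ := exists_cyclotomicCharacter_eq_intCast p (c := (ℓ : ℤ)) (by exact_mod_cast hℓ)
  exact ⟨σ, by rw [hσ, Int.cast_natCast]⟩

/-- **One Galois element per tame prime of the gauge**: a function `σ_• : ℕ → Γ_ℚ` with `χ_p(σ_ℓ) = ℓ` for every prime `ℓ ≠ p`
dividing `A` (the shape of clause (A5′) of the body). [cite: Washington1997, Ch. 14 (p. 321)] -/
theorem exists_cyclotomicCharacter_eq_primeFactors (A : ℕ) :
    ∃ σℓ : ℕ → absoluteGaloisGroup ℚ,
      ∀ ℓ ∈ A.primeFactors.erase p, ((GaloisRep.cyclotomicCharacter ℚ p (σℓ ℓ) : ℤ_[p]ˣ) : ℤ_[p]) = ℓ := by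
  classical
  have key : ∀ ℓ : ℕ, ∃ σ : absoluteGaloisGroup ℚ,
      ℓ ∈ A.primeFactors.erase p → ((GaloisRep.cyclotomicCharacter ℚ p σ : ℤ_[p]ˣ) : ℤ_[p]) = ℓ := by
    intro ℓ
    by_cases h : ℓ ∈ A.primeFactors.erase p
    · have hℓp : ¬ p ∣ ℓ := by
        obtain ⟨hne, hmem⟩ := Finset.mem_erase.mp h
        have hℓ : ℓ.Prime := Nat.prime_of_mem_primeFactors hmem
        intro hd
        exact hne ((Nat.prime_dvd_prime_iff_eq (Fact.out : p.Prime) hℓ).mp hd).symm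
      obtain ⟨σ, hσ⟩ := exists_cyclotomicCharacter_eq_natCast p hℓp
      exact ⟨σ, fun _ => hσ⟩
    · exact ⟨1, fun h' => absurd h' h⟩
  choose σℓ hσℓ using key
  exact ⟨σℓ, fun ℓ hℓ => hσℓ ℓ hℓ⟩

end Cyclotomic

/-! ## §3 The integrality input `hint` of the Λ-adic lift, DISCHARGED (Kato §8.2 functoriality = tree Mackey lemma) -/

section Integral

variable (W : WeierstrassCurve ℚ) [W.IsElliptic] (p : ℕ) [Fact p.Prime]
  [ContinuousSMul ℤ_[p] (W.tateModule p)] {κ : ZpExtension ℚ p} (hκ : κ.IsCyclotomic) (hp : p ≠ 2)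

/-- **`Cor : H¹(ℚ(μ_{p^{n+1}}), T_pW) → H¹(ℚ_n, T_pW)` preserves `H¹(ℤ[1/p], ·)`**: the corestriction `levelToLayer` of an integral
class is integral — the tree's general Mackey functoriality `coresLe_mem_integralH1_of_le` (no normality, no unramifiedness of the
level needed) applied to the definition of `levelToLayer`.  This is the `hint` input of
`IwasawaH1Data.existsUnique_lift_of_isEulerSystem_of_integral` («Kato §8.2; not yet a tree theorem» in that docstring — it now is).
[cite: Kato2004Asterisque, §8.2 and Lemma 8.5 (pp. 180–184), §13.1 (p. 224)] [cite: NeukirchSchmidtWingberg2008, (1.5.7)] -/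
theorem levelToLayer_mem_integralH1 (S : Set (HeightOneSpectrum (𝓞 ℚ))) (n : ℕ)
    {x : H1 (tateRep W p) ((cyclotomicLevelsRat p S).level (n + 1) ∅)}
    (hx : x ∈ integralH1 (tateRep W p) p ((cyclotomicLevelsRat p S).level (n + 1) ∅)) :
    levelToLayer W p hκ hp S n x ∈ integralH1 (tateRep W p) p (κ.layerSubgroup n) := by
  haveI : ((cyclotomicLevelsRat p S).level (n + 1) ∅).FiniteIndex :=
    finiteIndex_of_isOpen_of_compactSpace _ ((cyclotomicLevelsRat p S).isOpen_level (n + 1) ∅)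
  letI : Fintype (κ.layerSubgroup n ⧸
      ((cyclotomicLevelsRat p S).level (n + 1) ∅).subgroupOf (κ.layerSubgroup n)) :=
    Fintype.ofFinite _
  exact coresLe_mem_integralH1_of_le (tateRep W p) p _ _ hx

variable [Module.Free ℤ_[p] (W.tateModule p)] [Module.Finite ℤ_[p] (W.tateModule p)]

/-- **Clause (A4) of the body from `ZetaBody` alone**: an Euler system `z` satisfying `ZetaBody` ((C1) norm relations, (C2)
unramified away from `p` at class level) has a UNIQUE Λ-adic class `y ∈ I.H` in ANY pin `I` of `𝐇¹_Γ(T_pW)` (`Γ = Gal(ℚ_∞/ℚ)`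
cyclotomic, `p` odd) with `proj_n y = Cor(z_{n+1,∅})` for all `n` — (C1) feeds `IsEulerSystem`, (C2) feeds integrality via
`levelToLayer_mem_integralH1`.  So the REALISATION DATUM of (E2) does not depend on `K`, `γ` or `I`.
[cite: Kato2004Asterisque, (8.1.3) (p. 180), §8.2 (pp. 180–181), §13.1 and Thm. 13.4 (pp. 224–226)] -/
theorem existsUnique_lift_of_zetaBody {γ : absoluteGaloisGroup ℚ} (I : IwasawaH1Data W p κ γ)
    {N : ℕ} (f : CuspForm (Gamma0 N) 2) (ι : (m : ℕ) → (CyclotomicField m ℚ →+* ℂ)) (q : ℝ)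
    (Λ : ∀ (k : ℕ) (r : Finset (HeightOneSpectrum (𝓞 ℚ))),
      H1 (tateRep W p) (cycSubgroup p k r) →ₗ[ℤ_[p]] ℚ_[p] ⊗[ℚ] CyclotomicField (cycLevel p k r) ℚ)
    (c d₁ a : ℤ) (A : ℕ)
    (z : ∀ (k : ℕ) (r : (cyclotomicLevelsRat p (badPlaces c d₁ A N)).Ideals),
      H1 (tateRep W p) ((cyclotomicLevelsRat p (badPlaces c d₁ A N)).level k r.1))
    (x : ∀ (k : ℕ) (r : (cyclotomicLevelsRat p (badPlaces c d₁ A N)).Ideals), CyclotomicField (cycLevel p k r.1) ℚ)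
    (hzeta : ZetaBody W p f ι q Λ c d₁ a A z x) :
    ∃! y : I.H, ∀ n : ℕ,
      I.proj n y = levelToLayer W p hκ hp (badPlaces c d₁ A N) n
        (z (n + 1) (cyclotomicLevelsRat p (badPlaces c d₁ A N)).idealOne) :=
  IwasawaH1Data.existsUnique_lift_of_isEulerSystem_of_integral W p hκ hp I (badPlaces c d₁ A N) z hzeta.1
    (fun n => levelToLayer_mem_integralH1 W p hκ hp (badPlaces c d₁ A N) n
      ((mem_integralH1_iff _ _ _ _).mpr (hzeta.2.1 (n + 1) (cyclotomicLevelsRat p (badPlaces c d₁ A N)).idealOne)))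

end Integral

/-! ## §4 THE LETTER `F•`: `MemberRealisationBody W p` — Kato's value-pinned family REALISED for `(W, p)`, defined
Tate-normalised values, every admissible gauge, non-negative exponent (a `Prop`; nothing asserted) -/

set_option backward.isDefEq.respectTransparency false in
/-- **`F•` = `MemberRealisationBody W p`** — the (E2) RESIDUAL as a statement about `(W, p)` ALONE.  The local-field `letI` block,
the binders `N, f, IsNewformOf W f, ι, q, Λ` and clauses (R0) = (A0), (R1) = (A1) ∧ (A2) are VERBATIM those of
`Kato2004.HasMuFreeRealisedZetaFamilyBody` (minus `hp : p ≠ 2`, which only the lift needs); (R2) is the (A3)-family `∃ z x, ZetaBody …`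
for EVERY admissible gauge `(c, d₁, a, A, d′)` under the body's own guards [(8.1.3): Kato's `_{c,d}z_m^{(p)}` exist for all `c, d`
with `(c, 6p) = (d, 6pN) = 1`; Ex. 13.3 / (13.1.1): every `ξ = a(A)`]; (R3) is the body's scalar block with the Manin coordinates,
the Galois elements, `e` and the μ-clause REMOVED: `q⁻ > 0` generating the minus lattice (a theorem: §1), a period ratio
`ϖ ∈ ℚˣ` with `Ω⁺_f = ϖ·Ω_W` (a consequence of catalogued facts: `NewformPeriodRatio`), and the ONE member-dependent inequality
`0 ≤ v_p(ϖ/(q·q⁻))` (g67: `= 0` at Kato's member `W_K`; `< 0` off it).  What it SAYS in print terms: «for the curve `W` itself (not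
just some lattice `T ⊂ V_pW`), Kato's Euler system of (8.1.3)/Ex. 13.3 with values in `H¹(ℤ[1/p, μ_m], T_pW)` exists in every
admissible gauge, its values are the dual exponential `exp*` in a Tate-normalised coordinate with a RATIONAL non-zero constant `q`
(Thm. 9.7, 12.5 (1)), and `v_p(Ω⁺_f/(Ω_W·q·q⁻)) ≥ 0`».  A `Prop`; a HYPOTHESIS shape; nothing asserted.
[cite: Kato2004Asterisque, (8.1.3) (p. 180), Prop. 8.12 (p. 186), Thm. 9.7 (p. 189), Thm. 12.5 (1) (p. 221), Ex. 13.3 (p. 225), §13.12–13.14 (pp. 231–234)]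
[cite: BlochKato1990, Prop. 3.8 (p. 354)] [cite: Manin1972, Thm. 1.6 and Cor. 3.6] -/
def MemberRealisationBody (W : WeierstrassCurve ℚ) [W.IsElliptic] [W.IsGloballyMinimal] (p : ℕ) [Fact p.Prime]
    [ContinuousSMul ℤ_[p] (W.tateModule p)] [Module.Free ℤ_[p] (W.tateModule p)]
    [Module.Finite ℤ_[p] (W.tateModule p)] : Prop :=
  letI ρT := restrictedTateRep W (NumberField.Place.Completion (Sum.inr ((Rat.HeightOneSpectrum.primesEquiv (R := 𝓞 ℚ)).symm ⟨p, Fact.out⟩) : NumberField.Place ℚ)) p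
  letI : ValuativeRel (NumberField.Place.Completion (Sum.inr ((Rat.HeightOneSpectrum.primesEquiv (R := 𝓞 ℚ)).symm ⟨p, Fact.out⟩) : NumberField.Place ℚ)) :=
    inferInstanceAs (ValuativeRel (((Rat.HeightOneSpectrum.primesEquiv (R := 𝓞 ℚ)).symm ⟨p, Fact.out⟩).adicCompletion ℚ))
  letI : TopologicalSpace (NumberField.Place.Completion (Sum.inr ((Rat.HeightOneSpectrum.primesEquiv (R := 𝓞 ℚ)).symm ⟨p, Fact.out⟩) : NumberField.Place ℚ)) :=
    inferInstanceAs (TopologicalSpace (((Rat.HeightOneSpectrum.primesEquiv (R := 𝓞 ℚ)).symm ⟨p, Fact.out⟩).adicCompletion ℚ))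
  haveI : IsNonarchimedeanLocalField (NumberField.Place.Completion (Sum.inr ((Rat.HeightOneSpectrum.primesEquiv (R := 𝓞 ℚ)).symm ⟨p, Fact.out⟩) : NumberField.Place ℚ)) :=
    inferInstanceAs (IsNonarchimedeanLocalField (((Rat.HeightOneSpectrum.primesEquiv (R := 𝓞 ℚ)).symm ⟨p, Fact.out⟩).adicCompletion ℚ))
  haveI : CharZero (NumberField.Place.Completion (Sum.inr ((Rat.HeightOneSpectrum.primesEquiv (R := 𝓞 ℚ)).symm ⟨p, Fact.out⟩) : NumberField.Place ℚ)) := LocalField.charZero_adicCompletion ((Rat.HeightOneSpectrum.primesEquiv (R := 𝓞 ℚ)).symm ⟨p, Fact.out⟩)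
  letI : Algebra ℚ_[p] (NumberField.Place.Completion (Sum.inr ((Rat.HeightOneSpectrum.primesEquiv (R := 𝓞 ℚ)).symm ⟨p, Fact.out⟩) : NumberField.Place ℚ)) :=
    LocalField.adicCompletionPadicAlgebra ((Rat.HeightOneSpectrum.primesEquiv (R := 𝓞 ℚ)).symm ⟨p, Fact.out⟩) p ((natCast_mem_asIdeal_iff_eq_primesEquiv_symm _ (Fact.out : p.Prime)).mpr rfl)
  haveI : Fact (¬ IsUnit ((p : ℕ) : integerC (NumberField.Place.Completion (Sum.inr ((Rat.HeightOneSpectrum.primesEquiv (R := 𝓞 ℚ)).symm ⟨p, Fact.out⟩) : NumberField.Place ℚ)))) :=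
    ⟨not_isUnit_natCast_integerC (show valuation (NumberField.Place.Completion (Sum.inr ((Rat.HeightOneSpectrum.primesEquiv (R := 𝓞 ℚ)).symm ⟨p, Fact.out⟩) : NumberField.Place ℚ)) ((p : ℕ) : (NumberField.Place.Completion (Sum.inr ((Rat.HeightOneSpectrum.primesEquiv (R := 𝓞 ℚ)).symm ⟨p, Fact.out⟩) : NumberField.Place ℚ))) < 1 from LocalField.valuation_adicCompletion_natCast_lt_one ((Rat.HeightOneSpectrum.primesEquiv (R := 𝓞 ℚ)).symm ⟨p, Fact.out⟩) p ((natCast_mem_asIdeal_iff_eq_primesEquiv_symm _ (Fact.out : p.Prime)).mpr rfl))⟩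
  haveI := isAdicComplete_integerC_natCast (show valuation (NumberField.Place.Completion (Sum.inr ((Rat.HeightOneSpectrum.primesEquiv (R := 𝓞 ℚ)).symm ⟨p, Fact.out⟩) : NumberField.Place ℚ)) ((p : ℕ) : (NumberField.Place.Completion (Sum.inr ((Rat.HeightOneSpectrum.primesEquiv (R := 𝓞 ℚ)).symm ⟨p, Fact.out⟩) : NumberField.Place ℚ))) < 1 from LocalField.valuation_adicCompletion_natCast_lt_one ((Rat.HeightOneSpectrum.primesEquiv (R := 𝓞 ℚ)).symm ⟨p, Fact.out⟩) p ((natCast_mem_asIdeal_iff_eq_primesEquiv_symm _ (Fact.out : p.Prime)).mpr rfl))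
  -- the tree's `ℚ`-algebra structure on `ℚ_v` pinned, as in `AdmissibleZetaClassBody`
  letI : Algebra ℚ (NumberField.Place.Completion (Sum.inr ((Rat.HeightOneSpectrum.primesEquiv (R := 𝓞 ℚ)).symm ⟨p, Fact.out⟩) : NumberField.Place ℚ)) := NumberField.Place.instAlgebraCompletion (Sum.inr ((Rat.HeightOneSpectrum.primesEquiv (R := 𝓞 ℚ)).symm ⟨p, Fact.out⟩) : NumberField.Place ℚ)
  ∃ (N : ℕ) (_ : NeZero N) (f : CuspForm (Gamma0 N) 2) (_ : IsNewformOf W f)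
    (ι : (n : ℕ) → (CyclotomicField n ℚ →+* ℂ)) (q : ℚ)
    (Λ : ∀ (k : ℕ) (r : Finset (HeightOneSpectrum (𝓞 ℚ))),
      H1 (tateRep W p) (cycSubgroup p k r) →ₗ[ℤ_[p]] ℚ_[p] ⊗[ℚ] CyclotomicField (cycLevel p k r) ℚ),
    -- (R0) = (A0): the constant of the value law is non-zero (and rational: `q : ℚ`)
    q ≠ 0 ∧
    -- (R1) = (A1) ∧ (A2) VERBATIM: the value functional IS the dual exponential in a Tate-duality-normalised coordinate `d`
    (∃ d, DefinedExpStarBody W p f d ι ((q : ℚ) : ℝ) Λ ∧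
      ∀ a : (NumberField.Place.Completion (Sum.inr ((Rat.HeightOneSpectrum.primesEquiv (R := 𝓞 ℚ)).symm ⟨p, Fact.out⟩) : NumberField.Place ℚ)),
        (∃ η : contOneCocycles ρT.toTopRep, expStarCoord W (show valuation (NumberField.Place.Completion (Sum.inr ((Rat.HeightOneSpectrum.primesEquiv (R := 𝓞 ℚ)).symm ⟨p, Fact.out⟩) : NumberField.Place ℚ)) ((p : ℕ) : (NumberField.Place.Completion (Sum.inr ((Rat.HeightOneSpectrum.primesEquiv (R := 𝓞 ℚ)).symm ⟨p, Fact.out⟩) : NumberField.Place ℚ))) < 1 from LocalField.valuation_adicCompletion_natCast_lt_one ((Rat.HeightOneSpectrum.primesEquiv (R := 𝓞 ℚ)).symm ⟨p, Fact.out⟩) p ((natCast_mem_asIdeal_iff_eq_primesEquiv_symm _ (Fact.out : p.Prime)).mpr rfl)) d η = a) ↔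
          ∀ Q : (W.baseChange ℚ_[p]).toAffine.Point,
            ‖(Padic.adicCompletionEquiv (𝓞 ℚ) ⟨p, Fact.out⟩).symm
                (show ((Rat.HeightOneSpectrum.primesEquiv (R := 𝓞 ℚ)).symm ⟨p, Fact.out⟩).adicCompletion ℚ from a) * padicLogLocal W p Q‖ ≤ 1) ∧
    -- (R2) = (A3)-∀gauge: for EVERY admissible gauge, THE family with these values EXISTS
    (∀ (c d₁ a : ℤ) (A : ℕ) (d' : ℤ),
      0 < A → Int.gcd c (6 * p * A) = 1 → Int.gcd d₁ (6 * p * N) = 1 → (d₁ : ℤ) * d' ≡ 1 [ZMOD (A : ℤ)] →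
      ratCuspFactor f true c d₁ a A d' ≠ 0 →
        ∃ (z : ∀ (k : ℕ) (r : (cyclotomicLevelsRat p (badPlaces c d₁ A N)).Ideals),
            H1 (tateRep W p) ((cyclotomicLevelsRat p (badPlaces c d₁ A N)).level k r.1))
          (x : ∀ (k : ℕ) (r : (cyclotomicLevelsRat p (badPlaces c d₁ A N)).Ideals),
            CyclotomicField (cycLevel p k r.1) ℚ),
          ZetaBody W p f ι ((q : ℚ) : ℝ) Λ c d₁ a A z x) ∧
    -- (R3) = (A5′)-scalars without `n₁ … n₄`, `σ_c σ_{d₁} σ_ℓ`, `e`, and WITHOUT the μ-clause: `q⁻`, `ϖ`, and `0 ≤ v_p(ϖ/(q·q⁻))`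
    ∃ (qm perRatio : ℚ),
      0 < qm ∧ AddSubgroup.closure (Set.range (ratMinusSymbol f)) = AddSubgroup.zmultiples qm ∧
      perRatio ≠ 0 ∧ plusPeriod f = ((perRatio : ℚ) : ℝ) * W.realPeriodRat ∧
      0 ≤ padicValRat p (perRatio / (q * qm))

/-- `F•` CLOSED over the structure facts of `T_pW` (tree theorems `module_free/finite_tateModule_holds`), exactly as
`Kato2004.HasMuFreeRealisedZetaFamily` closes its body. [cite: Kato2004Asterisque, Thm. 12.5 (1) (p. 221)] -/
def MemberRealisation (W : WeierstrassCurve ℚ) [W.IsElliptic] [W.IsGloballyMinimal] (p : ℕ) [Fact p.Prime]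
    [ContinuousSMul ℤ_[p] (W.tateModule p)] : Prop :=
  letI : Module.Free ℤ_[p] (W.tateModule p) := W.module_free_tateModule_holds p
  letI : Module.Finite ℤ_[p] (W.tateModule p) := W.module_finite_tateModule_holds p
  MemberRealisationBody W p

/-! ## §5 KERNEL ASSEMBLY: `F• → HasMuFreeRealisedZetaFamilyBody` for every cyclotomic `K`, every `γ`, every pin `I` (`p` odd) -/

section Assembly

variable {W : WeierstrassCurve ℚ} [W.IsElliptic] [W.IsGloballyMinimal] {p : ℕ} [Fact p.Prime]
  [ContinuousSMul ℤ_[p] (W.tateModule p)]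

set_option backward.isDefEq.respectTransparency false in
/-- **THE ASSEMBLY.**  `MemberRealisationBody W p → HasMuFreeRealisedZetaFamilyBody W p K hK I` for `p ≠ 2`, every cyclotomic
`ℤ_p`-extension `K`, every `γ`, every `IwasawaH1Data` pin `I`: instantiate (R2) at g66's diagonal gauge (★ `exists_diagonalGauge`,
fed by (R3)'s `q⁻`), lift the `p`-power levels into `I` (§3, from (C1)+(C2) of `ZetaBody`), pick `σ_c, σ_{d₁}, σ_ℓ` by §2, put
`e := v_p(ϖ/(q·q⁻))`, and take the μ-clause from ★★ `muFree_conjunct_of_diagonalGauge`.  Kernel; no fact consumed.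
[cite: Kato2004Asterisque, §13.9 (p. 229), Lemma 13.10 (1) (p. 230), §13.12–13.14 (pp. 231–234)] -/
theorem hasMuFreeRealisedZetaFamilyBody_of_memberRealisationBody [Module.Free ℤ_[p] (W.tateModule p)]
    [Module.Finite ℤ_[p] (W.tateModule p)] (hp : p ≠ 2) (h : MemberRealisationBody W p)
    (K : ZpExtension ℚ p) (hK : K.IsCyclotomic) {γ : absoluteGaloisGroup ℚ} (I : IwasawaH1Data W p K γ) :
    HasMuFreeRealisedZetaFamilyBody W p K hK I := by
  obtain ⟨N, hN, f, hf, ι, q, Λ, hq, hR1, hfam, qm, perRatio, hqm, hspan, hper0, hper, he⟩ := h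
  -- (A3): the diagonal gauge with its Manin coordinates (g66 ★)
  obtain ⟨c, d₁, a, A, d', n, hA, hc, hd, hdd', hRne, h₁, h₂, h₃, h₄, hpn, hpc, hpd, hc1, hc1', hd1, hd1', -⟩ :=
    G66.exists_diagonalGauge (p := p) f hqm hspan
  -- the family in that gauge
  obtain ⟨z, x, hzeta⟩ := hfam c d₁ a A d' hA hc hd hdd' hRne
  -- (A4): the Λ-adic lift into the given pin
  obtain ⟨y, hy, -⟩ := existsUnique_lift_of_zetaBody W p hK hp I f ι _ Λ c d₁ a A z x hzeta
  -- (A5′): Galois elements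
  obtain ⟨σc, hσc⟩ := exists_cyclotomicCharacter_eq_intCast p hpc
  obtain ⟨σd, hσd⟩ := exists_cyclotomicCharacter_eq_intCast p hpd
  obtain ⟨σℓ, hσℓ⟩ := exists_cyclotomicCharacter_eq_primeFactors p A
  exact ⟨hp, N, hN, f, hf, ι, q, Λ, hq, hR1, c, d₁, a, A, d', hA, hc, hd, hdd', hRne, z, x, hzeta, y, hy,
    qm, perRatio, padicValRat p (perRatio / (q * qm)), n, n, n, n, σc, σd, σℓ, hqm, hspan, h₁, h₂, h₃, h₄,
    hσc, hσd, hσℓ, hper0, hper, rfl,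
    G66.muFree_conjunct_of_diagonalGauge K hK hpc hpd hc1 hc1' hd1 hd1' hpn hσc hσd hσℓ _ _, he⟩

/-- The CLOSED form: `MemberRealisation W p → HasMuFreeRealisedZetaFamily W p K hK I` (`p ≠ 2`).
[cite: Kato2004Asterisque, §13.12–13.14 (pp. 231–234)] -/
theorem hasMuFreeRealisedZetaFamily_of_memberRealisation (hp : p ≠ 2) (h : MemberRealisation W p)
    (K : ZpExtension ℚ p) (hK : K.IsCyclotomic) {γ : absoluteGaloisGroup ℚ} (I : IwasawaH1Data W p K γ) :
    HasMuFreeRealisedZetaFamily W p K hK I := by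
  letI : Module.Free ℤ_[p] (W.tateModule p) := W.module_free_tateModule_holds p
  letI : Module.Finite ℤ_[p] (W.tateModule p) := W.module_finite_tateModule_holds p
  exact hasMuFreeRealisedZetaFamilyBody_of_memberRealisationBody hp h K hK I

/-- **Remark-lemma (R3's `ϖ` is not content)**: the period-ratio clause of `F•` follows from the two catalogued facts
`nonempty_modularParametrizationData` (BCDT + Néron-lattice datum) and Carayol's `IsNewformOf.level_eq_conductorNorm` — tree
`exists_ne_zero_rat_mul_realPeriodRat_eq_plusPeriod_of_facts`, restated in the body's orientation `plusPeriod f = ϖ * Ω_W`.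
[cite: EdixhovenManin1991, §1] [cite: Carayol1986] -/
theorem exists_perRatio_of_facts (h₁ : nonempty_modularParametrizationData)
    (h₂ : ∀ {N : ℕ} [NeZero N], IsNewformOf.level_eq_conductorNorm (N := N))
    {N : ℕ} [NeZero N] (f : CuspForm (Gamma0 N) 2) (hf : IsNewformOf W f) :
    ∃ perRatio : ℚ, perRatio ≠ 0 ∧ plusPeriod f = ((perRatio : ℚ) : ℝ) * W.realPeriodRat := by
  obtain ⟨ϖ, hϖ, h⟩ := exists_ne_zero_rat_mul_realPeriodRat_eq_plusPeriod_of_facts h₁ h₂ W f hf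
  exact ⟨ϖ, hϖ, h.symm⟩

end Assembly

/-! ## §6 MEMBER FORM AT `p = 7` and the bridge to the (E2) stub statement VERBATIM -/

/-- **`F•₇` — the member-form letter for class 𝒞₇** (the statement the cell may vote as the (E2) named fact, or prove): every
𝒞₇ curve has a globally minimal ISOGENOUS member `W′` (Kato's member `W_K`, g67) with `MemberRealisation W′ 7`.  A `Prop`; nothing
asserted. [cite: Kato2004Asterisque, (8.1.3) (p. 180), Thm. 12.5 (1) (p. 221), §13.12–13.14 (pp. 231–234)] -/
def ClassCSevenMemberRealisation : Prop :=
  ∀ (W : WeierstrassCurve ℚ) [W.IsElliptic] [W.IsGloballyMinimal] [Fact (Nat.Prime 7)], X12.ClassCSeven W →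
    ∃ (W' : WeierstrassCurve ℚ) (_ : W'.IsElliptic) (_ : W'.IsGloballyMinimal), IsIsogenous W W' ∧
      letI : ContinuousSMul ℤ_[7] (W'.tateModule 7) := TateModule.continuousSMul_padicInt
      MemberRealisation W' 7

/-- **THE BRIDGE TO (E2)**: `F•₇` implies the statement of `stub_muFreeRealisedFamilySeven` of `Lines/kato_perrin_riou_zp.lean`
v14 VERBATIM (same witness `W′`; `7 ≠ 2` by `decide`).  Kernel; CONDITIONAL on `F•₇`; (E2) itself is NOT proved here.
[cite: Kato2004Asterisque, §13.12–13.14 (pp. 231–234)] -/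
theorem muFreeRealisedFamilySeven_of_classCSevenMemberRealisation (h : ClassCSevenMemberRealisation) :
    ∀ (W : WeierstrassCurve ℚ) [W.IsElliptic] [W.IsGloballyMinimal] [Fact (Nat.Prime 7)], X12.ClassCSeven W →
      ∃ (W' : WeierstrassCurve ℚ) (_ : W'.IsElliptic) (_ : W'.IsGloballyMinimal), IsIsogenous W W' ∧
        letI : ContinuousSMul ℤ_[7] (W'.tateModule 7) := TateModule.continuousSMul_padicInt
        ∀ (K : ZpExtension ℚ 7) (hK : K.IsCyclotomic) (γ : Field.absoluteGaloisGroup ℚ) (_ : K.IsTopGenerator γ)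
          (I : IwasawaH1Data W' 7 K γ), Kato2004.HasMuFreeRealisedZetaFamily W' 7 K hK I := by
  intro W _ _ _ hC
  obtain ⟨W', hE', hM', hiso, hF⟩ := h W hC
  refine ⟨W', hE', hM', hiso, ?_⟩
  letI : ContinuousSMul ℤ_[7] (W'.tateModule 7) := TateModule.continuousSMul_padicInt
  intro K hK γ _ I
  exact hasMuFreeRealisedZetaFamily_of_memberRealisation (by decide) hF K hK I

/-! ## §7 IDENTITY CHECK against the v14 consumer (built library module, not the crux workfile): the bridge's conclusion IS the
`hE2` binder of `GenusSeven.primitiveAdmissibleMemberSeven_of_integralComparison_upToUnit` — the theorem v14's composition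
`primitiveAdmissibleMemberSeven_of … stub_muFreeRealisedFamilySeven` applies with (E2) as its LAST argument — so under `F•₇` the
v14 composition elaborates with `muFreeRealisedFamilySeven_of_classCSevenMemberRealisation h` in place of the stub (kernel). -/

/-- v14's 2★-composition with the (E2) slot filled by the bridge (all other slots kept as binders, their types inferred from the
consumer).  CONDITIONAL on `F•₇` and on v14's remaining inputs; nothing closes. [cite: Kato2004Asterisque, Thm. 12.5 (1)(4) (pp. 221–222)] -/
example (h : ClassCSevenMemberRealisation) :=
  fun a₁ a₂ a₃ a₄ a₅ a₆ a₇ =>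
    Additive.GenusSeven.primitiveAdmissibleMemberSeven_of_integralComparison_upToUnit a₁ a₂ a₃ a₄ a₅ a₆ a₇
      (muFreeRealisedFamilySeven_of_classCSevenMemberRealisation h)

end Summit.BirchSwinnertonDyer.BirchSwinnertonDyer.Cruxes.EllipticUnitValueSevenOfGZK.RealisationAssembly

end
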